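import Summits.CriticalPhenomena.PercolationContinuityZ3.Theorems.PercNearOneGluingNoHeavyLowerTailConditionedChampionExchange
import HarnessLib

/-!
# `NoHeavyLowerTail` (stmt-CriticalPhenomena-4575) — the quantitative attached exchange and the SUM-ODDS case of the
# restricted-attachment exchange (REX for every observer when the members' odds sum to at most one)

Support file (lemma factory #8 `prim-lf-8`, gen 11; `--supports stmt-CriticalPhenomena-4575`).  No definitions, no named
facts, no sorries.  `μ = prodBernoulli w` on `Fin n`, relays `A`, level `j`, `π(z) = {a ∈ A : z ↔ a}`, `L_z = {|π(z)| ≤ j}`,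
`H_z = {|π(z)| > j}`, `U = ⋃_{x∈Q} {o↔x}`, odds `r_x = cc_x / CC_x`, `cc_x = μ(L_x ∩ H_q)`, `CC_x = μ(H_x ∩ L_q)`.

* `SumOddsExchange.attachedExchange_product` — **quantitative PEX** (one BHK two-set exchange in the frame `({x},{q})`,
  `setTwoClusterExchange` with `A₁ = {o↔x}`, `B₁ = L_x ∩ H_q`, `A₂ = H_x ∩ L_q`):
  `μ({o↔x} ∩ L_x ∩ H_q) · μ(H_x ∩ L_q) ≤ μ({o↔x} ∩ H_x ∩ L_q) · μ(L_x ∩ H_q)` — the attached odds are at most the relay's odds,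
  for EVERY observer `o` and without any beating hypothesis (the `|Q| = 1` case of RMAX/UREX).
* `SumOddsExchange.attached_le_of_odds` — hence `μ({o↔x} ∩ L_x ∩ H_q) ≤ θ · μ({o↔x} ∩ H_x ∩ L_q)` whenever `cc_x ≤ θ · CC_x`, `θ ≥ 0`.
* `SumOddsExchange.rex_of_sumOdds` — **REX in the sum-odds regime**: if there are `θ_x ≥ 0` with `Σ_{x∈Q} θ_x ≤ 1` and
  `cc_x ≤ θ_x · CC_x` for `x ∈ Q` (e.g. `Σ_x r_x ≤ 1`), then for EVERY observer `o` (any vertex, any neighbourhood)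
  `μ(U ∩ L_o ∩ H_q) ≤ μ(U ∩ H_o ∩ L_q)`: union bound over the attached member, `attached_le_of_odds`, and
  `μ({o↔x} ∩ H_x ∩ L_q) ≤ μ(U ∩ H_o ∩ L_q)`.  Seat census (lab-gen11/sumodds.py): the hypothesis `Σ r_x ≤ 1` holds in 81 % of random
  beating instances with `|Q| = 2` and 73 % with `|Q| = 3`; the open part of REX(2) is the near-tie regime `r_a + r_b > 1`.
-/

noncomputable section

namespace Summit.CriticalPhenomena.PercolationContinuityZ3.Theorems

open MeasureTheory Set Literature.Probability.LatticeModels Literature.Probability.Percolation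
open scoped Classical BigOperators

variable {n : ℕ}

namespace SumOddsExchange

open ConditionedChampionExchange

/-- **Quantitative attached exchange (PEX in product form).**  For all vertices `o, x, q` and every level:
`μ({o↔x} ∩ L_x ∩ H_q) · μ(H_x ∩ L_q) ≤ μ({o↔x} ∩ H_x ∩ L_q) · μ(L_x ∩ H_q)`.
[cite: VandenbergHaggstromKahn2005, Thm. 2.1 (p. 9) at q = 1 — corollary] -/
theorem attachedExchange_product (w : Sym2 (Fin n) → unitInterval) (A : Finset (Fin n)) (o x q : Fin n) (j : ℕ) :
    (prodBernoulli w).real (((openConn o x : Set (BondConfig (Fin n))) ∩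
          {ω | (A.filter fun r => ω ∈ openConn x r).card ≤ j}) ∩ {ω | j < (A.filter fun r => ω ∈ openConn q r).card}) *
      (prodBernoulli w).real ({ω : BondConfig (Fin n) | j < (A.filter fun r => ω ∈ openConn x r).card} ∩
          {ω | (A.filter fun r => ω ∈ openConn q r).card ≤ j}) ≤
    (prodBernoulli w).real (((openConn o x : Set (BondConfig (Fin n))) ∩
          {ω | j < (A.filter fun r => ω ∈ openConn x r).card}) ∩ {ω | (A.filter fun r => ω ∈ openConn q r).card ≤ j}) *
      (prodBernoulli w).real ({ω : BondConfig (Fin n) | (A.filter fun r => ω ∈ openConn x r).card ≤ j} ∩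
          {ω | j < (A.filter fun r => ω ∈ openConn q r).card}) := by
  set μ := prodBernoulli w with hμ
  set K : Set (BondConfig (Fin n)) := (openConn o x : Set (BondConfig (Fin n))) with hK
  set D : Set (BondConfig (Fin n)) := (openConn x q : Set (BondConfig (Fin n)))ᶜ with hD
  set Lx : Set (BondConfig (Fin n)) := {ω | (A.filter fun r => ω ∈ openConn x r).card ≤ j} with hLx
  set Hx : Set (BondConfig (Fin n)) := {ω | j < (A.filter fun r => ω ∈ openConn x r).card} with hHx
  set Lq : Set (BondConfig (Fin n)) := {ω | (A.filter fun r => ω ∈ openConn q r).card ≤ j} with hLq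
  set Hq : Set (BondConfig (Fin n)) := {ω | j < (A.filter fun r => ω ∈ openConn q r).card} with hHq
  have hx : x ∈ ({x} : Set (Fin n)) := mem_singleton x
  have key := setTwoClusterExchange w ({x} : Set (Fin n)) ({q} : Set (Fin n))
    (A₁ := K) (A₂ := Hx ∩ Lq) (B₁ := Lx ∩ Hq) (B₂ := univ)
    (fun ω ω' hs ht h => by
      have h' : ω ∈ (openConn x o : Set (BondConfig (Fin n))) := by rw [KNPreFKG.openConn_symm x o]; exact h
      have := TwoSetExchange.typePlus_openConn_of_mem _ _ hx o hs ht h'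
      show ω' ∈ (openConn o x : Set (BondConfig (Fin n)))
      rw [KNPreFKG.openConn_symm o x]; exact this)
    (fun ω ω' hs ht h => ⟨heavy_typePlus A x q j hs ht h.1, light_typePlus A x q j hs ht h.2⟩)
    (fun ω ω' hs ht h => ⟨light_typePlus A q x j ht hs h.1, heavy_typePlus A q x j ht hs h.2⟩)
    (fun _ _ _ _ _ => mem_univ _)
  rw [sep_singletons_eq x q] at key
  simp only [inter_univ] at key
  change μ.real (D ∩ (K ∩ (Lx ∩ Hq))) * μ.real (D ∩ (Hx ∩ Lq)) ≤ μ.real (D ∩ (K ∩ (Hx ∩ Lq))) * μ.real (D ∩ (Lx ∩ Hq)) at key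
  -- the separation `D = {x ↮ q}` is automatic on every lightness mismatch
  have hLH : Lx ∩ Hq ⊆ D := by
    rintro ω ⟨hl, hh⟩ hk
    simp only [hLx, hHq, mem_setOf_eq] at hl hh
    rw [filter_eq_of_openConn A hk] at hl
    exact absurd hl (not_le.2 hh)
  have hHL : Hx ∩ Lq ⊆ D := by
    rintro ω ⟨hh, hl⟩ hk
    simp only [hHx, hLq, mem_setOf_eq] at hl hh
    rw [filter_eq_of_openConn A hk] at hh
    exact absurd hl (not_le.2 hh)
  have e1 : D ∩ (K ∩ (Lx ∩ Hq)) = K ∩ Lx ∩ Hq := by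
    ext ω; constructor
    · rintro ⟨-, hk, hl, hh⟩; exact ⟨⟨hk, hl⟩, hh⟩
    · rintro ⟨⟨hk, hl⟩, hh⟩; exact ⟨hLH ⟨hl, hh⟩, hk, hl, hh⟩
  have e2 : D ∩ (K ∩ (Hx ∩ Lq)) = K ∩ Hx ∩ Lq := by
    ext ω; constructor
    · rintro ⟨-, hk, hh, hl⟩; exact ⟨⟨hk, hh⟩, hl⟩
    · rintro ⟨⟨hk, hh⟩, hl⟩; exact ⟨hHL ⟨hh, hl⟩, hk, hh, hl⟩
  have e3 : D ∩ (Hx ∩ Lq) = Hx ∩ Lq := inter_eq_right.2 hHL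
  have e4 : D ∩ (Lx ∩ Hq) = Lx ∩ Hq := inter_eq_right.2 hLH
  rw [e1, e2, e3, e4] at key
  exact key

/-- The attached light mass is at most `θ` times the attached heavy mass whenever `cc_x ≤ θ · CC_x` (`θ ≥ 0`). [this work] -/
theorem attached_le_of_odds (w : Sym2 (Fin n) → unitInterval) (A : Finset (Fin n)) (o x q : Fin n) (j : ℕ) (θ : ℝ)
    (hθ : 0 ≤ θ)
    (hodds : (prodBernoulli w).real ({ω : BondConfig (Fin n) | (A.filter fun r => ω ∈ openConn x r).card ≤ j} ∩
          {ω | j < (A.filter fun r => ω ∈ openConn q r).card}) ≤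
      θ * (prodBernoulli w).real ({ω : BondConfig (Fin n) | j < (A.filter fun r => ω ∈ openConn x r).card} ∩
          {ω | (A.filter fun r => ω ∈ openConn q r).card ≤ j})) :
    (prodBernoulli w).real (((openConn o x : Set (BondConfig (Fin n))) ∩
          {ω | (A.filter fun r => ω ∈ openConn x r).card ≤ j}) ∩ {ω | j < (A.filter fun r => ω ∈ openConn q r).card}) ≤
      θ * (prodBernoulli w).real (((openConn o x : Set (BondConfig (Fin n))) ∩
          {ω | j < (A.filter fun r => ω ∈ openConn x r).card}) ∩ {ω | (A.filter fun r => ω ∈ openConn q r).card ≤ j}) := by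
  set μ := prodBernoulli w with hμ
  have hnn : ∀ s : Set (BondConfig (Fin n)), 0 ≤ μ.real s := fun _ => measureReal_nonneg
  have key := attachedExchange_product w A o x q j
  set X := μ.real (((openConn o x : Set (BondConfig (Fin n))) ∩
          {ω | (A.filter fun r => ω ∈ openConn x r).card ≤ j}) ∩ {ω | j < (A.filter fun r => ω ∈ openConn q r).card}) with hX
  set Y := μ.real (((openConn o x : Set (BondConfig (Fin n))) ∩
          {ω | j < (A.filter fun r => ω ∈ openConn x r).card}) ∩ {ω | (A.filter fun r => ω ∈ openConn q r).card ≤ j}) with hY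
  set cc := μ.real ({ω : BondConfig (Fin n) | (A.filter fun r => ω ∈ openConn x r).card ≤ j} ∩
          {ω | j < (A.filter fun r => ω ∈ openConn q r).card}) with hcc
  set CC := μ.real ({ω : BondConfig (Fin n) | j < (A.filter fun r => ω ∈ openConn x r).card} ∩
          {ω | (A.filter fun r => ω ∈ openConn q r).card ≤ j}) with hCC
  change X * CC ≤ Y * cc at key
  by_cases hpos : 0 < CC
  · have h1 : X * CC ≤ (θ * Y) * CC := by
      calc X * CC ≤ Y * cc := key
        _ ≤ Y * (θ * CC) := mul_le_mul_of_nonneg_left hodds (hnn _)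
        _ = (θ * Y) * CC := by ring
    exact le_of_mul_le_mul_right h1 hpos
  · have h0 : CC = 0 := le_antisymm (not_lt.1 hpos) (hnn _)
    have hcc0 : cc = 0 := le_antisymm (by rw [h0, mul_zero] at hodds; exact hodds) (hnn _)
    have hX0 : X ≤ cc := measureReal_mono (fun ω hω => ⟨hω.1.2, hω.2⟩) (measure_ne_top _ _)
    have : X = 0 := le_antisymm (hcc0 ▸ hX0) (hnn _)
    rw [this]; exact mul_nonneg hθ (hnn _)

/-- **REX in the sum-odds regime, for every observer.**  If `θ_x ≥ 0`, `Σ_{x∈Q} θ_x ≤ 1` and `cc_x ≤ θ_x · CC_x` for all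
`x ∈ Q` (for instance the odds `r_x = cc_x/CC_x` of the members of `Q` against `q` sum to at most one), then for every vertex `o`
`μ(U ∩ L_o ∩ H_q) ≤ μ(U ∩ H_o ∩ L_q)`, `U = ⋃_{x∈Q} {o↔x}`. [this work] -/
theorem rex_of_sumOdds (w : Sym2 (Fin n) → unitInterval) (A Q : Finset (Fin n)) (o q : Fin n) (j : ℕ) (θ : Fin n → ℝ)
    (hθ : ∀ x ∈ Q, 0 ≤ θ x) (hsum : ∑ x ∈ Q, θ x ≤ 1)
    (hodds : ∀ x ∈ Q, (prodBernoulli w).real ({ω : BondConfig (Fin n) | (A.filter fun r => ω ∈ openConn x r).card ≤ j} ∩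
          {ω | j < (A.filter fun r => ω ∈ openConn q r).card}) ≤
      θ x * (prodBernoulli w).real ({ω : BondConfig (Fin n) | j < (A.filter fun r => ω ∈ openConn x r).card} ∩
          {ω | (A.filter fun r => ω ∈ openConn q r).card ≤ j})) :
    (prodBernoulli w).real ((⋃ x ∈ Q, (openConn o x : Set (BondConfig (Fin n)))) ∩
          {ω | (A.filter fun a => ω ∈ openConn o a).card ≤ j} ∩ {ω | j < (A.filter fun a => ω ∈ openConn q a).card}) ≤
      (prodBernoulli w).real ((⋃ x ∈ Q, (openConn o x : Set (BondConfig (Fin n)))) ∩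
          {ω | j < (A.filter fun a => ω ∈ openConn o a).card} ∩ {ω | (A.filter fun a => ω ∈ openConn q a).card ≤ j}) := by
  set μ := prodBernoulli w with hμ
  set Lo : Set (BondConfig (Fin n)) := {ω | (A.filter fun a => ω ∈ openConn o a).card ≤ j} with hLo
  set Ho : Set (BondConfig (Fin n)) := {ω | j < (A.filter fun a => ω ∈ openConn o a).card} with hHo
  set Lq : Set (BondConfig (Fin n)) := {ω | (A.filter fun a => ω ∈ openConn q a).card ≤ j} with hLq
  set Hq : Set (BondConfig (Fin n)) := {ω | j < (A.filter fun a => ω ∈ openConn q a).card} with hHq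
  set U : Set (BondConfig (Fin n)) := ⋃ x ∈ Q, (openConn o x : Set (BondConfig (Fin n))) with hU
  have hnn : ∀ s : Set (BondConfig (Fin n)), 0 ≤ μ.real s := fun _ => measureReal_nonneg
  have mono : ∀ {s t : Set (BondConfig (Fin n))}, s ⊆ t → μ.real s ≤ μ.real t :=
    fun h => measureReal_mono h (measure_ne_top μ _)
  -- member events
  set Xs : Fin n → Set (BondConfig (Fin n)) := fun x => ((openConn o x : Set (BondConfig (Fin n))) ∩
      {ω | (A.filter fun r => ω ∈ openConn x r).card ≤ j}) ∩ Hq with hXs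
  set Ys : Fin n → Set (BondConfig (Fin n)) := fun x => ((openConn o x : Set (BondConfig (Fin n))) ∩
      {ω | j < (A.filter fun r => ω ∈ openConn x r).card}) ∩ Lq with hYs
  -- union bound on the light side: on `{o↔x}` the observer's relay set is `x`'s
  have hsub : U ∩ Lo ∩ Hq ⊆ ⋃ x ∈ Q, Xs x := by
    rintro ω ⟨⟨hUω, hl⟩, hh⟩
    rw [hU] at hUω
    obtain ⟨x, hx, hox⟩ := mem_iUnion₂.1 hUω
    refine mem_biUnion hx ⟨⟨hox, ?_⟩, hh⟩
    show (A.filter fun r => ω ∈ openConn x r).card ≤ j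
    rw [← filter_eq_of_openConn A hox]; exact hl
  have h1 : μ.real (U ∩ Lo ∩ Hq) ≤ ∑ x ∈ Q, μ.real (Xs x) :=
    le_trans (mono hsub) (measureReal_biUnion_finset_le Q Xs)
  -- each heavy member event lies in the heavy attached event
  have hY : ∀ x ∈ Q, μ.real (Ys x) ≤ μ.real (U ∩ Ho ∩ Lq) := by
    intro x hx
    refine mono ?_
    rintro ω ⟨⟨hox, hh⟩, hl⟩
    refine ⟨⟨?_, ?_⟩, hl⟩
    · rw [hU]; exact mem_biUnion hx hox
    · show j < (A.filter fun r => ω ∈ openConn o r).card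
      rw [filter_eq_of_openConn A hox]; exact hh
  have h2 : ∀ x ∈ Q, μ.real (Xs x) ≤ θ x * μ.real (U ∩ Ho ∩ Lq) := by
    intro x hx
    calc μ.real (Xs x) ≤ θ x * μ.real (Ys x) := attached_le_of_odds w A o x q j (θ x) (hθ x hx) (hodds x hx)
      _ ≤ θ x * μ.real (U ∩ Ho ∩ Lq) := mul_le_mul_of_nonneg_left (hY x hx) (hθ x hx)
  calc μ.real (U ∩ Lo ∩ Hq) ≤ ∑ x ∈ Q, μ.real (Xs x) := h1
    _ ≤ ∑ x ∈ Q, θ x * μ.real (U ∩ Ho ∩ Lq) := Finset.sum_le_sum h2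
    _ = (∑ x ∈ Q, θ x) * μ.real (U ∩ Ho ∩ Lq) := by rw [Finset.sum_mul]
    _ ≤ 1 * μ.real (U ∩ Ho ∩ Lq) := mul_le_mul_of_nonneg_right hsum (hnn _)
    _ = μ.real (U ∩ Ho ∩ Lq) := one_mul _

/-! ### Appendix (gen 11, second landing): UREX at one relay, and the inclusion–exclusion criterion for a pair -/

/-- **UREX for `|Q| = 1` (hypothesis-free).**  For every observer `o` and relays `x, q`:
`μ({o↔x} ∩ L_x ∩ H_q) − μ({o↔x} ∩ H_x ∩ L_q) ≤ max(0, μ(L_x ∩ H_q) − μ(H_x ∩ L_q))` (`= max(0, S(x) − S(q))`): the attached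
exchange deficit is at most the positive part of `x`'s lightness advantage. [this work] -/
theorem urex_singleton (w : Sym2 (Fin n) → unitInterval) (A : Finset (Fin n)) (o x q : Fin n) (j : ℕ) :
    (prodBernoulli w).real (((openConn o x : Set (BondConfig (Fin n))) ∩
          {ω | (A.filter fun r => ω ∈ openConn x r).card ≤ j}) ∩ {ω | j < (A.filter fun r => ω ∈ openConn q r).card}) -
      (prodBernoulli w).real (((openConn o x : Set (BondConfig (Fin n))) ∩
          {ω | j < (A.filter fun r => ω ∈ openConn x r).card}) ∩ {ω | (A.filter fun r => ω ∈ openConn q r).card ≤ j}) ≤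
    max 0 ((prodBernoulli w).real ({ω : BondConfig (Fin n) | (A.filter fun r => ω ∈ openConn x r).card ≤ j} ∩
          {ω | j < (A.filter fun r => ω ∈ openConn q r).card}) -
      (prodBernoulli w).real ({ω : BondConfig (Fin n) | j < (A.filter fun r => ω ∈ openConn x r).card} ∩
          {ω | (A.filter fun r => ω ∈ openConn q r).card ≤ j})) := by
  set μ := prodBernoulli w with hμ
  have hnn : ∀ s : Set (BondConfig (Fin n)), 0 ≤ μ.real s := fun _ => measureReal_nonneg
  have mono : ∀ {s t : Set (BondConfig (Fin n))}, s ⊆ t → μ.real s ≤ μ.real t :=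
    fun h => measureReal_mono h (measure_ne_top μ _)
  have key := attachedExchange_product w A o x q j
  set X := μ.real (((openConn o x : Set (BondConfig (Fin n))) ∩
          {ω | (A.filter fun r => ω ∈ openConn x r).card ≤ j}) ∩ {ω | j < (A.filter fun r => ω ∈ openConn q r).card}) with hX
  set Y := μ.real (((openConn o x : Set (BondConfig (Fin n))) ∩
          {ω | j < (A.filter fun r => ω ∈ openConn x r).card}) ∩ {ω | (A.filter fun r => ω ∈ openConn q r).card ≤ j}) with hY
  set cc := μ.real ({ω : BondConfig (Fin n) | (A.filter fun r => ω ∈ openConn x r).card ≤ j} ∩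
          {ω | j < (A.filter fun r => ω ∈ openConn q r).card}) with hcc
  set CC := μ.real ({ω : BondConfig (Fin n) | j < (A.filter fun r => ω ∈ openConn x r).card} ∩
          {ω | (A.filter fun r => ω ∈ openConn q r).card ≤ j}) with hCC
  change X * CC ≤ Y * cc at key
  have hXcc : X ≤ cc := mono (fun ω hω => ⟨hω.1.2, hω.2⟩)
  have hYCC : Y ≤ CC := mono (fun ω hω => ⟨hω.1.2, hω.2⟩)
  by_cases hle : cc ≤ CC
  · -- `q` beats `x`: `X ≤ Y`
    have h1 : X - Y ≤ 0 := by
      by_cases hpos : 0 < CC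
      · have : X * CC ≤ Y * CC := le_trans key (mul_le_mul_of_nonneg_left hle (hnn _))
        have := le_of_mul_le_mul_right this hpos
        linarith
      · have h0 : CC = 0 := le_antisymm (not_lt.1 hpos) (hnn _)
        have : cc = 0 := le_antisymm (h0 ▸ hle) (hnn _)
        linarith [hnn (((openConn o x : Set (BondConfig (Fin n))) ∩
          {ω | j < (A.filter fun r => ω ∈ openConn x r).card}) ∩ {ω | (A.filter fun r => ω ∈ openConn q r).card ≤ j})]
    exact le_trans h1 (le_max_left _ _)
  · -- `x` beats `q`: `X - Y ≤ (cc - CC) · (Y / CC) ≤ cc - CC`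
    push Not at hle
    refine le_trans ?_ (le_max_right _ _)
    by_cases hpos : 0 < CC
    · -- `X ≤ Y·cc/CC`, so `X - Y ≤ Y (cc - CC)/CC ≤ cc - CC` since `Y ≤ CC`
      have h1 : X * CC ≤ Y * cc := key
      have h2 : (X - Y) * CC ≤ (cc - CC) * Y := by nlinarith
      have h3 : (cc - CC) * Y ≤ (cc - CC) * CC := mul_le_mul_of_nonneg_left hYCC (by linarith)
      have h4 : (X - Y) * CC ≤ (cc - CC) * CC := le_trans h2 h3
      exact le_of_mul_le_mul_right h4 hpos
    · have h0 : CC = 0 := le_antisymm (not_lt.1 hpos) (hnn _)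
      have hY0 : Y = 0 := le_antisymm (h0 ▸ hYCC) (hnn _)
      rw [hY0, h0]; linarith

/-- **Pair bookkeeping, light side.**  With `U = {o↔a} ∪ {o↔b}` and `cc_x ≤ θ_x · CC_x` (`θ_x ≥ 0`):
`μ(U ∩ L_o ∩ H_q) ≤ θ_a · μ({o↔a} ∩ H_a ∩ L_q) + θ_b · μ({o↔b} ∩ H_b ∩ L_q) − μ({o↔a} ∩ {o↔b} ∩ L_o ∩ H_q)`
(inclusion–exclusion and `attached_le_of_odds`). [this work] -/
theorem pair_light_le (w : Sym2 (Fin n) → unitInterval) (A : Finset (Fin n)) (o a b q : Fin n) (j : ℕ) (θa θb : ℝ)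
    (hθa : 0 ≤ θa) (hθb : 0 ≤ θb)
    (ha : (prodBernoulli w).real ({ω : BondConfig (Fin n) | (A.filter fun r => ω ∈ openConn a r).card ≤ j} ∩
          {ω | j < (A.filter fun r => ω ∈ openConn q r).card}) ≤
      θa * (prodBernoulli w).real ({ω : BondConfig (Fin n) | j < (A.filter fun r => ω ∈ openConn a r).card} ∩
          {ω | (A.filter fun r => ω ∈ openConn q r).card ≤ j}))
    (hb : (prodBernoulli w).real ({ω : BondConfig (Fin n) | (A.filter fun r => ω ∈ openConn b r).card ≤ j} ∩
          {ω | j < (A.filter fun r => ω ∈ openConn q r).card}) ≤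
      θb * (prodBernoulli w).real ({ω : BondConfig (Fin n) | j < (A.filter fun r => ω ∈ openConn b r).card} ∩
          {ω | (A.filter fun r => ω ∈ openConn q r).card ≤ j})) :
    (prodBernoulli w).real ((((openConn o a : Set (BondConfig (Fin n))) ∪ (openConn o b : Set (BondConfig (Fin n)))) ∩
        {ω | (A.filter fun r => ω ∈ openConn o r).card ≤ j}) ∩ {ω | j < (A.filter fun r => ω ∈ openConn q r).card}) ≤
      θa * (prodBernoulli w).real (((openConn o a : Set (BondConfig (Fin n))) ∩
          {ω | j < (A.filter fun r => ω ∈ openConn a r).card}) ∩ {ω | (A.filter fun r => ω ∈ openConn q r).card ≤ j}) +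
      θb * (prodBernoulli w).real (((openConn o b : Set (BondConfig (Fin n))) ∩
          {ω | j < (A.filter fun r => ω ∈ openConn b r).card}) ∩ {ω | (A.filter fun r => ω ∈ openConn q r).card ≤ j}) -
      (prodBernoulli w).real ((((openConn o a : Set (BondConfig (Fin n))) ∩ (openConn o b : Set (BondConfig (Fin n)))) ∩
        {ω | (A.filter fun r => ω ∈ openConn o r).card ≤ j}) ∩ {ω | j < (A.filter fun r => ω ∈ openConn q r).card}) := by
  set μ := prodBernoulli w with hμ
  have hmeas : ∀ s : Set (BondConfig (Fin n)), MeasurableSet s := fun _ => MeasurableSet.of_discrete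
  set Ka : Set (BondConfig (Fin n)) := (openConn o a : Set (BondConfig (Fin n))) with hKa
  set Kb : Set (BondConfig (Fin n)) := (openConn o b : Set (BondConfig (Fin n))) with hKb
  set Lo : Set (BondConfig (Fin n)) := {ω | (A.filter fun r => ω ∈ openConn o r).card ≤ j} with hLo
  set Hq : Set (BondConfig (Fin n)) := {ω | j < (A.filter fun r => ω ∈ openConn q r).card} with hHq
  set Xa := μ.real (((openConn o a : Set (BondConfig (Fin n))) ∩
          {ω | (A.filter fun r => ω ∈ openConn a r).card ≤ j}) ∩ Hq) with hXa
  set Xb := μ.real (((openConn o b : Set (BondConfig (Fin n))) ∩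
          {ω | (A.filter fun r => ω ∈ openConn b r).card ≤ j}) ∩ Hq) with hXb
  -- the two attached light events, written with the observer's own lightness
  have ea : Ka ∩ Lo ∩ Hq = ((openConn o a : Set (BondConfig (Fin n))) ∩
      {ω | (A.filter fun r => ω ∈ openConn a r).card ≤ j}) ∩ Hq := by
    ext ω; simp only [mem_inter_iff, hLo, mem_setOf_eq, hKa]
    constructor
    · rintro ⟨⟨hk, hl⟩, hh⟩; exact ⟨⟨hk, by rwa [← filter_eq_of_openConn A hk]⟩, hh⟩
    · rintro ⟨⟨hk, hl⟩, hh⟩; exact ⟨⟨hk, by rwa [filter_eq_of_openConn A hk]⟩, hh⟩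
  have eb : Kb ∩ Lo ∩ Hq = ((openConn o b : Set (BondConfig (Fin n))) ∩
      {ω | (A.filter fun r => ω ∈ openConn b r).card ≤ j}) ∩ Hq := by
    ext ω; simp only [mem_inter_iff, hLo, mem_setOf_eq, hKb]
    constructor
    · rintro ⟨⟨hk, hl⟩, hh⟩; exact ⟨⟨hk, by rwa [← filter_eq_of_openConn A hk]⟩, hh⟩
    · rintro ⟨⟨hk, hl⟩, hh⟩; exact ⟨⟨hk, by rwa [filter_eq_of_openConn A hk]⟩, hh⟩
  -- inclusion–exclusion
  have hIE : μ.real ((Ka ∪ Kb) ∩ Lo ∩ Hq) + μ.real ((Ka ∩ Kb) ∩ Lo ∩ Hq) =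
      μ.real (Ka ∩ Lo ∩ Hq) + μ.real (Kb ∩ Lo ∩ Hq) := by
    have e1 : (Ka ∪ Kb) ∩ Lo ∩ Hq = (Ka ∩ Lo ∩ Hq) ∪ (Kb ∩ Lo ∩ Hq) := by
      ext ω; simp only [mem_inter_iff, mem_union]; tauto
    have e2 : (Ka ∩ Kb) ∩ Lo ∩ Hq = (Ka ∩ Lo ∩ Hq) ∩ (Kb ∩ Lo ∩ Hq) := by
      ext ω; simp only [mem_inter_iff]; tauto
    rw [e1, e2]
    exact measureReal_union_add_inter (hmeas _) (measure_ne_top _ _) (measure_ne_top _ _)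
  have h1 : μ.real (Ka ∩ Lo ∩ Hq) ≤ θa * μ.real (((openConn o a : Set (BondConfig (Fin n))) ∩
          {ω | j < (A.filter fun r => ω ∈ openConn a r).card}) ∩ {ω | (A.filter fun r => ω ∈ openConn q r).card ≤ j}) := by
    rw [ea]; exact attached_le_of_odds w A o a q j θa hθa ha
  have h2 : μ.real (Kb ∩ Lo ∩ Hq) ≤ θb * μ.real (((openConn o b : Set (BondConfig (Fin n))) ∩
          {ω | j < (A.filter fun r => ω ∈ openConn b r).card}) ∩ {ω | (A.filter fun r => ω ∈ openConn q r).card ≤ j}) := by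
    rw [eb]; exact attached_le_of_odds w A o b q j θb hθb hb
  linarith

/-- **Pair bookkeeping, heavy side.**  `μ(U ∩ H_o ∩ L_q) = μ({o↔a} ∩ H_a ∩ L_q) + μ({o↔b} ∩ H_b ∩ L_q) − μ({o↔a} ∩ {o↔b} ∩ H_o ∩ L_q)`.
Together with `pair_light_le`: REX(`{a,b}`; `q`) holds for the observer `o` as soon as
`(1 − θ_a)·μ({o↔a} ∩ H_a ∩ L_q) + (1 − θ_b)·μ({o↔b} ∩ H_b ∩ L_q) ≥ μ({o↔a,b} ∩ H_o ∩ L_q) − μ({o↔a,b} ∩ L_o ∩ H_q)`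
(the inclusion–exclusion criterion; seat census: 87 % of random beating instances). [this work] -/
theorem pair_heavy_eq (w : Sym2 (Fin n) → unitInterval) (A : Finset (Fin n)) (o a b q : Fin n) (j : ℕ) :
    (prodBernoulli w).real ((((openConn o a : Set (BondConfig (Fin n))) ∪ (openConn o b : Set (BondConfig (Fin n)))) ∩
        {ω | j < (A.filter fun r => ω ∈ openConn o r).card}) ∩ {ω | (A.filter fun r => ω ∈ openConn q r).card ≤ j}) =
      (prodBernoulli w).real (((openConn o a : Set (BondConfig (Fin n))) ∩
          {ω | j < (A.filter fun r => ω ∈ openConn a r).card}) ∩ {ω | (A.filter fun r => ω ∈ openConn q r).card ≤ j}) +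
      (prodBernoulli w).real (((openConn o b : Set (BondConfig (Fin n))) ∩
          {ω | j < (A.filter fun r => ω ∈ openConn b r).card}) ∩ {ω | (A.filter fun r => ω ∈ openConn q r).card ≤ j}) -
      (prodBernoulli w).real ((((openConn o a : Set (BondConfig (Fin n))) ∩ (openConn o b : Set (BondConfig (Fin n)))) ∩
        {ω | j < (A.filter fun r => ω ∈ openConn o r).card}) ∩ {ω | (A.filter fun r => ω ∈ openConn q r).card ≤ j}) := by
  set μ := prodBernoulli w with hμ
  have hmeas : ∀ s : Set (BondConfig (Fin n)), MeasurableSet s := fun _ => MeasurableSet.of_discrete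
  set Ka : Set (BondConfig (Fin n)) := (openConn o a : Set (BondConfig (Fin n))) with hKa
  set Kb : Set (BondConfig (Fin n)) := (openConn o b : Set (BondConfig (Fin n))) with hKb
  set Ho : Set (BondConfig (Fin n)) := {ω | j < (A.filter fun r => ω ∈ openConn o r).card} with hHo
  set Lq : Set (BondConfig (Fin n)) := {ω | (A.filter fun r => ω ∈ openConn q r).card ≤ j} with hLq
  have ea : Ka ∩ Ho ∩ Lq = ((openConn o a : Set (BondConfig (Fin n))) ∩
      {ω | j < (A.filter fun r => ω ∈ openConn a r).card}) ∩ Lq := by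
    ext ω; simp only [mem_inter_iff, hHo, mem_setOf_eq, hKa]
    constructor
    · rintro ⟨⟨hk, hh⟩, hl⟩; exact ⟨⟨hk, by rwa [← filter_eq_of_openConn A hk]⟩, hl⟩
    · rintro ⟨⟨hk, hh⟩, hl⟩; exact ⟨⟨hk, by rwa [filter_eq_of_openConn A hk]⟩, hl⟩
  have eb : Kb ∩ Ho ∩ Lq = ((openConn o b : Set (BondConfig (Fin n))) ∩
      {ω | j < (A.filter fun r => ω ∈ openConn b r).card}) ∩ Lq := by
    ext ω; simp only [mem_inter_iff, hHo, mem_setOf_eq, hKb]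
    constructor
    · rintro ⟨⟨hk, hh⟩, hl⟩; exact ⟨⟨hk, by rwa [← filter_eq_of_openConn A hk]⟩, hl⟩
    · rintro ⟨⟨hk, hh⟩, hl⟩; exact ⟨⟨hk, by rwa [filter_eq_of_openConn A hk]⟩, hl⟩
  have hIE : μ.real ((Ka ∪ Kb) ∩ Ho ∩ Lq) + μ.real ((Ka ∩ Kb) ∩ Ho ∩ Lq) =
      μ.real (Ka ∩ Ho ∩ Lq) + μ.real (Kb ∩ Ho ∩ Lq) := by
    have e1 : (Ka ∪ Kb) ∩ Ho ∩ Lq = (Ka ∩ Ho ∩ Lq) ∪ (Kb ∩ Ho ∩ Lq) := by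
      ext ω; simp only [mem_inter_iff, mem_union]; tauto
    have e2 : (Ka ∩ Kb) ∩ Ho ∩ Lq = (Ka ∩ Ho ∩ Lq) ∩ (Kb ∩ Ho ∩ Lq) := by
      ext ω; simp only [mem_inter_iff]; tauto
    rw [e1, e2]
    exact measureReal_union_add_inter (hmeas _) (measure_ne_top _ _) (measure_ne_top _ _)
  rw [← ea, ← eb]
  linarith

end SumOddsExchange

end Summit.CriticalPhenomena.PercolationContinuityZ3.Theorems

end
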